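import Summits.Ventures.CertifiedManyBodySolver.Theorems.M3x2EdgeSplitSymReplayFill
import Summits.Ventures.CertifiedManyBodySolver.Theorems.M3x2EdgeSplitSymReplayLocalB

/-!
# SymReplay checker — `fillCertL`: the slot fill of `…Fill` over the LOCAL executed pipeline of `…LocalB` (T13′/T14′ × T16)

`…Fill` (pen hub-lb-dual-eng-3) computes the residual of a certificate through `rhsPoly`, whose Ward / EOM commutators
run against the WHOLE frame (`comm (spinPlusPoly K.frame) X`, `comm (hamPoly K.frame) B`): harmless on a 25-site frame,
≈ 7·10⁴ s of products on the 625-site frame of a rung-V object (hub-lb-sym-ref-1, STATUS 2026-08-28 l.1402/l.1463).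
This module is the same fill, byte for byte in its rules, over the local residual `residualL K = lhsPoly K − rhsPolyL K`
(support-pruned commutators, `…LocalA`) and the zero-filtered executed canonical pipe of `identityOKLV` (`…LocalB`):
* `canonPipeLV K p` — `collect ∘ nfPoly`, drop zeros, `canonTermAV (minCornerP frame)` when `K.useCanon`, collect, prune
  (exactly the polynomial `identityOKLV` tests, so `identityOKLV K = true ↔ canonPipeLV K (residualL K) = []`);
* `residualLV`, `fillSlackL`, `fillAntiHL`, `fillCertL`, `fillCert2L` — as `residualV`, `fillSlack`, `fillAntiH`, `fillCert`,
  `fillCert2` of `…Fill` with `canonPipeV ↦ canonPipeLV`, `rhsPoly ↦ rhsPolyL`.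
Closing grammar for a filled certificate on the local path: `cert := fillCertL (decodeSymCert (toksOf [...]))`, ONE
`native_decide` for `symCheckLV cert && decide (symValue cert = v)`, then `energyDensity_ge_symValueLV cert h` (…LocalB) verbatim.
Soundness is untouched: `energyDensity_ge_symValueLV` quantifies over every `SymCert`; a fill that does not close simply
fails `symCheckLV`.  No summit or crux statement is proved here; no certificate is landed by this file; nothing here
predicts superconductivity.
-/

namespace Summit.Ventures.CertifiedManyBodySolver.Theorems.SymReplay

open Literature.Probability.LatticeModels (Site)

section FillL

/-- The executed LOCAL identity pipeline of `identityOKLV` on an arbitrary polynomial `p` in the frame of `K`: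
normal-order, collect, drop zeros, canonicalise by the anchored affine-`D₄` canonicaliser (when `K.useCanon`), collect,
prune zeros. -/
def canonPipeLV (K : SymCert) (p : QPoly) : QPoly :=
  pruneZ (collect (if K.useCanon then canonNFZV K.frame p else dropZeros (collect (nfPoly p))))

/-- **The local residual** of the certificate identity for `K` as given (all slots): the collected canonical polynomial
`LHS − RHS_L(K)`; `K` passes `identityOKLV` iff this is `[]`. -/
def residualLV (K : SymCert) : QPoly := canonPipeLV K (residualL K)

/-- `fillSlack` over the local pipeline: the slack slot becomes the local residual of `K` with its slack EMPTIED. -/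
def fillSlackL (K : SymCert) : SymCert :=
  { K with slack := residualLV { K with slack := [] } }

/-- `fillAntiH` over the local pipeline: empty `slack` and `antiH`, compute the local residual `R` and its canonical
adjoint image `R†`, set `antiH := [(b/2) • [(1, w)] | (b, w) ∈ R†]`; the slack slot is left EMPTY. -/
def fillAntiHL (K : SymCert) : SymCert :=
  let K0 : SymCert := { K with slack := [], antiH := [] }
  let R := residualLV K0
  let Rdag := canonPipeLV K (padj R)
  { K0 with antiH := Rdag.map fun t => (t.1 / 2, [((1 : ℚ), t.2)]) }

/-- **`fillCertL`** — `fillSlackL ∘ fillAntiHL` with ONE expensive pass (the rule of `fillCert`, local pipeline):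
residual `R` of `K` with both slots emptied, `antiH` from `R† = canonPipeLV K (padj R)`, final slack from
`R − antiHPoly antiH` by one cheap pass; residual words with nonzero particle or spin charge go to `charged`. -/
def fillCertL (K : SymCert) : SymCert :=
  let K0 : SymCert := { K with slack := [], antiH := [] }
  let R := residualLV K0
  let Rdag := canonPipeLV K (padj R)
  let A : List (ℚ × QPoly) := Rdag.map fun t => (t.1 / 2, [((1 : ℚ), t.2)])
  let S := canonPipeLV K (R ++ pscale (-1) (antiHPoly A))
  let CS := S.partition fun t => wordCharge t.2 != 0 || wordSpinCharge t.2 != 0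
  { K0 with antiH := A, charged := K0.charged ++ CS.1, slack := CS.2 }

/-- `fillCertL` by TWO full local passes (reference semantics; slower, for cross-checks). -/
def fillCert2L (K : SymCert) : SymCert := fillSlackL (fillAntiHL K)

/-! ### Kernel demos on T1's toy certificates (`decide +kernel`, no `Lean.ofReduceBool`) -/

/-- The one-bond toy certificate closes on the local path with zero residual. -/
example : residualLV toyCert = [] := by decide +kernel

/-- `fillCertL` of a certificate that already closes: still accepted by the local executed checker. -/
example : symCheckLV (fillCertL toyCanonCert) = true := by decide +kernel

/-- Perturb the constant of the `useCanon` toy by `+1/7`: the local identity no longer closes … -/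
example : identityOKLV { toyCanonCert with c := toyCanonCert.c + 1/7 } = false := by decide +kernel

/-- … `fillCertL` repairs it by ONE slack term on the empty word, priced `1/7`: the certified value is unchanged. -/
example : symCheckLV (fillCertL { toyCanonCert with c := toyCanonCert.c + 1/7 }) = true ∧
    symValue (fillCertL { toyCanonCert with c := toyCanonCert.c + 1/7 }) = symValue toyCanonCert := by
  constructor
  · decide +kernel
  · decide +kernel

/-- The local and the dense fill agree on the toy (same slack slot, through the checker's own zero test). -/
example : isZero (psub (fillCertL { toyCanonCert with c := toyCanonCert.c + 1/7 }).slack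
    (fillCert { toyCanonCert with c := toyCanonCert.c + 1/7 }).slack) = true := by decide +kernel

end FillL

end Summit.Ventures.CertifiedManyBodySolver.Theorems.SymReplay
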